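import Literature.MathematicalPhysics.QuantumFieldTheory.Balaban1983to89.B1Eq110GaugeOrbit

/-!
# `Balaban1983to89.B1Eq110OrbitGaussians` — T. Bałaban, *(Higgs)₂,₃ quantum fields in a finite volume. I. A lower bound*,
Commun. Math. Phys. **85** (1982) 603–626 [Balaban1982Higgs1], p. 605, (1.9)–(1.11): ORBIT INTEGRALS over the gauge group of the
lattice Higgs model — the exchange identity, the Faddeev–Popov normalisation `∫dλ e^{−½‖∂^{ε*}(A+∂^ελ)‖²} = c_FP` (independent of `A`),
and **the two gauge-orbit Gaussians** of the Proca weight of (1.8)/(1.9) and of the Feynman-gauge weight of (1.10)/(1.11),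
`∫dλ e^{−½μ₀²‖A−∂λ‖²} = e^{−½μ₀²‖A^⊥‖²}·c′`, `∫dλ e^{−½μ₀²‖A−∂λ‖² − ½‖∂*(A−∂λ)‖²} = e^{−½μ₀²‖A^⊥‖²}·c` (the "gauge-orbit volume
factors" `c′`, `c` of the row) — PROVED on the carrier `…Balaban1983to89.HiggsLattice`

statement-level skeleton of published theorems with citation tags; proofs where landed; nothing here is a claim about the Yang–Mills mass gap

PDF held: `paper:balaban1982-cmp85-higgs23-i` (journal page = PDF page + 602), p. 605 [PDF 3].

WHAT IS REPRODUCED.  Fourth of the six lit-balaban seat-p28 (gen 8) files on SKELETON row **B1.Eq1.9-1.10** (owners r01/r14);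
p. 605, verbatim: *"In Sect. 5.1 the authors [of [5] = Brydges–Fröhlich–Seiler, Ann. Phys. 121 (1979), NOT HELD (acq-09341) —
nothing is quoted from it] have shown how to introduce the gauge fixing terms in the integral (1.9), using the properties of (1.8)
under the gauge transformations."*  With the pinned gauge functions, the Poisson solution `λ_A = poisson A` and the transverse part
`A^⊥ = perp A` of `…B1Eq110GaugeOrbit`, and the mass / gauge-fixing terms `massTerm`, `divTerm` of `…HiggsGaugeInvariance` /
`…HiggsHodgeIdentity` (§0, private generic lemmas: coercivity `a·Σ_i v_i² ≤ Σ_j(Mv)_j²` of injective linear maps, finiteness of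
`∫dv e^{−(c/2)Σ_j(Mv)_j²}` by domination by a product of one-dimensional Gaussians, positivity of `∫dv e^{h(v)}`):
* `orbM g A = ∫dλ g(A − ∂^ηλ)`, `orbP g A = ∫dλ g(A + ∂^ηλ)` over pinned `λ` (Lebesgue measure `dλ`); **the exchange identity**
  `∫dA f(A)·orbP g A = ∫dA (orbM f A)·g(A)` (`lintegral_mul_orbP`: Tonelli + translation invariance of `dA`);
* the Faddeev–Popov density `gFP A = e^{−½‖∂^{η*}A‖²_η}` and **`orbP gFP A = c_FP` for every `A`** (`orbP_gFP`, translating `λ` by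
  `λ_A`), `0 < c_FP < ∞` (`cFP_pos`, `cFP_lt_top`);
* the orbit Gaussians `orbM (e^{−massTerm}) A = e^{−½μ₀²‖A^⊥‖²_η}·c′` (`gPerp`, `orbM_massWeight`; Hodge orthogonality
  `‖A^⊥ − ∂λ‖² = ‖A^⊥‖² + ‖∂λ‖²`) and `orbM (e^{−massTerm − divTerm}) A = e^{−½μ₀²‖A^⊥‖²_η}·c` (`orbM_fullWeight`), with
  `c′ = cPrime = ∫dλ e^{−½μ₀²‖∂^ηλ‖²_η}`, `c = cFull = ∫dλ e^{−½μ₀²‖∂^ηλ‖²_η − ½‖∂^{η*}∂^ηλ‖²_η}`, `0 < c ≤ c′` (`cFull_pos`,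
  `cFull_le_cPrime`) and `c′ < ∞` for `μ₀² > 0` (`cPrime_lt_top`, `cFull_lt_top`: the Proca form is positive definite on pinned gauge
  functions).
The identity (1.9) ↔ (1.10) is assembled in `…B1Eq110GaugeFixing`.  Nothing of [Balaban1982Higgs1] beyond the quoted sentence is
asserted; no `Prop`-valued fact is introduced.  Unit `lit-balaban-p28` (Phase-2 proof seat p28, gen 8; DEPGRAPH node `EXT:BFS1979`
at its B1 use), HOME `run/shared/lean/pub/lit-balaban/`.
-/

open scoped BigOperators ENNReal
open _root_.MeasureTheory

namespace Literature.MathematicalPhysics.QuantumFieldTheory.Balaban1983to89.B1Eq110OrbitGaussians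

open HiggsLattice HiggsCovariancePos HiggsHodgeIdentity HiggsGaugeInvariance B1Eq110GaugeOrbit

variable {P : Params} {k N : ℕ}

noncomputable section

/-! ## §0 Gaussian integrals of positive definite lattice forms (generic lemmas) -/

/-- **Coercivity** of an injective linear map `M : R^ι → R^κ` (finite dimensions): `a·Σ_i v_i² ≤ Σ_j (Mv)_j²` for some `a > 0`
(the inverse on the range is bounded). [folklore] -/
private theorem exists_coercive {ι κ : Type*} [Fintype ι] [Fintype κ] (M : (ι → ℝ) →ₗ[ℝ] (κ → ℝ)) (hM : Function.Injective M) :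
    ∃ a : ℝ, 0 < a ∧ ∀ v : ι → ℝ, a * ∑ i, (v i) ^ 2 ≤ ∑ j, (M v j) ^ 2 := by
  let e : (ι → ℝ) ≃ₗ[ℝ] LinearMap.range M := LinearEquiv.ofInjective M hM
  let T : LinearMap.range M →L[ℝ] (ι → ℝ) :=
    LinearMap.toContinuousLinearMap (e.symm : LinearMap.range M →ₗ[ℝ] (ι → ℝ))
  have hT : ∀ v : ι → ℝ, T ⟨M v, LinearMap.mem_range_self M v⟩ = v := by
    intro v
    have he : (⟨M v, LinearMap.mem_range_self M v⟩ : LinearMap.range M) = e v :=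
      Subtype.ext (by simp [e])
    change e.symm ⟨M v, LinearMap.mem_range_self M v⟩ = v
    rw [he, LinearEquiv.symm_apply_apply]
  set C := ‖T‖ with hC
  refine ⟨1 / ((Fintype.card ι : ℝ) * C ^ 2 + 1), by positivity, fun v => ?_⟩
  have h1 : ‖v‖ ≤ C * ‖M v‖ := by
    have h := T.le_opNorm ⟨M v, LinearMap.mem_range_self M v⟩
    rw [hT] at h
    exact h
  have h2 : ∑ i, (v i) ^ 2 ≤ (Fintype.card ι : ℝ) * ‖v‖ ^ 2 := by
    have hi : ∀ i, (v i) ^ 2 ≤ ‖v‖ ^ 2 := fun i => by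
      have h := norm_le_pi_norm v i
      rw [Real.norm_eq_abs] at h
      calc (v i) ^ 2 = |v i| ^ 2 := (sq_abs _).symm
        _ ≤ ‖v‖ ^ 2 := pow_le_pow_left₀ (abs_nonneg _) h 2
    calc ∑ i, (v i) ^ 2 ≤ ∑ _i : ι, ‖v‖ ^ 2 := Finset.sum_le_sum fun i _ => hi i
      _ = (Fintype.card ι : ℝ) * ‖v‖ ^ 2 := by simp
  have h3 : ‖M v‖ ^ 2 ≤ ∑ j, (M v j) ^ 2 := by
    have hS : 0 ≤ ∑ j, (M v j) ^ 2 := Finset.sum_nonneg fun j _ => sq_nonneg _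
    have hle : ‖M v‖ ≤ Real.sqrt (∑ j, (M v j) ^ 2) := by
      refine (pi_norm_le_iff_of_nonneg (Real.sqrt_nonneg _)).2 fun j => ?_
      rw [Real.norm_eq_abs]
      exact Real.abs_le_sqrt (Finset.single_le_sum (fun j _ => sq_nonneg (M v j)) (Finset.mem_univ j))
    calc ‖M v‖ ^ 2 ≤ (Real.sqrt (∑ j, (M v j) ^ 2)) ^ 2 := pow_le_pow_left₀ (norm_nonneg _) hle 2
      _ = ∑ j, (M v j) ^ 2 := Real.sq_sqrt hS
  have hS : 0 ≤ ∑ j, (M v j) ^ 2 := Finset.sum_nonneg fun j _ => sq_nonneg _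
  have hC0 : 0 ≤ C := by rw [hC]; exact norm_nonneg T
  have h4 : ∑ i, (v i) ^ 2 ≤ ((Fintype.card ι : ℝ) * C ^ 2) * ∑ j, (M v j) ^ 2 :=
    calc ∑ i, (v i) ^ 2 ≤ (Fintype.card ι : ℝ) * ‖v‖ ^ 2 := h2
      _ ≤ (Fintype.card ι : ℝ) * (C * ‖M v‖) ^ 2 := by gcongr
      _ = ((Fintype.card ι : ℝ) * C ^ 2) * ‖M v‖ ^ 2 := by ring
      _ ≤ ((Fintype.card ι : ℝ) * C ^ 2) * ∑ j, (M v j) ^ 2 := by gcongr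
  rw [one_div, inv_mul_le_iff₀ (by positivity)]
  nlinarith [h4, hS]

/-- **Gaussian integrals of positive definite lattice forms are finite**: for an injective linear `M : R^ι → R^κ` and `c > 0`,
`∫ dv exp(−(c/2) Σ_j (Mv)_j²) < ∞` (domination by a product of one-dimensional Gaussians via coercivity). [folklore] -/
private theorem lintegral_exp_neg_quadratic_lt_top {ι κ : Type*} [Fintype ι] [Fintype κ]
    (M : (ι → ℝ) →ₗ[ℝ] (κ → ℝ)) (hM : Function.Injective M) {c : ℝ} (hc : 0 < c) :
    ∫⁻ v : ι → ℝ, ENNReal.ofReal (Real.exp (-(c / 2 * ∑ j, (M v j) ^ 2))) < ∞ := by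
  obtain ⟨a, ha, hcoer⟩ := exists_coercive M hM
  have hint : Integrable (fun v : ι → ℝ => ∏ i, Real.exp (-(c * a / 2) * (v i) ^ 2)) :=
    Integrable.fintype_prod (f := fun (_ : ι) (t : ℝ) => Real.exp (-(c * a / 2) * t ^ 2))
      (fun _ => integrable_exp_neg_mul_sq (by positivity))
  refine lt_of_le_of_lt (lintegral_mono fun v => ?_) hint.lintegral_lt_top
  have hprod : ∏ i, Real.exp (-(c * a / 2) * (v i) ^ 2) = Real.exp (-(c * a / 2) * ∑ i, (v i) ^ 2) := by
    rw [Finset.mul_sum, Real.exp_sum]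
  simp only [hprod]
  refine ENNReal.ofReal_le_ofReal (Real.exp_le_exp.2 ?_)
  have h := mul_le_mul_of_nonneg_left (hcoer v) hc.le
  linarith

/-- a `lintegral` of `exp` of a continuous real function is positive (Lebesgue measure charges open sets). [folklore] -/
private theorem lintegral_exp_pos {ι : Type*} [Fintype ι] {h : (ι → ℝ) → ℝ} (hh : Continuous h) :
    0 < ∫⁻ v : ι → ℝ, ENNReal.ofReal (Real.exp (h v)) := by
  have hm : Measurable fun v : ι → ℝ => ENNReal.ofReal (Real.exp (h v)) :=
    ENNReal.measurable_ofReal.comp (Real.continuous_exp.comp hh).measurable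
  rw [pos_iff_ne_zero, Ne, lintegral_eq_zero_iff hm]
  intro hae
  have : (volume : Measure (ι → ℝ)) Set.univ = 0 := by
    have h0 : ∀ᵐ v ∂(volume : Measure (ι → ℝ)), False := by
      filter_upwards [hae] with v hv
      have : (0 : ℝ≥0∞) < ENNReal.ofReal (Real.exp (h v)) := ENNReal.ofReal_pos.2 (Real.exp_pos _)
      rw [hv] at this
      exact lt_irrefl _ this
    simpa [ae_iff] using h0
  exact (isOpen_univ.measure_ne_zero (volume : Measure (ι → ℝ)) Set.univ_nonempty) this

/-! ## §1 Orbit integrals, the Faddeev–Popov normalisation, the two gauge-orbit Gaussians -/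

/-- The orbit integral `∫dλ g(A − ∂^ηλ)` over pinned gauge functions. [cite: Balaban1982Higgs1, (1.9) p.605] -/
def orbM (g : VecField P k → ℝ≥0∞) (A : VecField P k) : ℝ≥0∞ := ∫⁻ ν : Pinned P k → ℝ, g (A - grad (ext0 ν))

/-- The orbit integral `∫dλ g(A + ∂^ηλ)` over pinned gauge functions. [cite: Balaban1982Higgs1, (1.9) p.605] -/
def orbP (g : VecField P k → ℝ≥0∞) (A : VecField P k) : ℝ≥0∞ := ∫⁻ ν : Pinned P k → ℝ, g (A + grad (ext0 ν))

/-- **The exchange identity** `∫dA f(A)·(∫dλ g(A+∂^ηλ)) = ∫dA (∫dλ f(A−∂^ηλ))·g(A)` (Tonelli and the translation invariance of the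
Lebesgue measure `dA`). [cite: Balaban1982Higgs1, (1.9) p.605] -/
theorem lintegral_mul_orbP (f g : VecField P k → ℝ≥0∞) (hf : Measurable f) (hg : Measurable g) :
    ∫⁻ A, f A * orbP g A = ∫⁻ A, orbM f A * g A := by
  have hgm : ∀ A : VecField P k, Measurable fun ν : Pinned P k → ℝ => g (A + grad (ext0 ν)) :=
    fun A => hg.comp (continuous_const.add continuous_grad0).measurable
  have hfm : ∀ A : VecField P k, Measurable fun ν : Pinned P k → ℝ => f (A - grad (ext0 ν)) :=
    fun A => hf.comp (continuous_const.sub continuous_grad0).measurable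
  have hj1 : Measurable (Function.uncurry fun (A : VecField P k) (ν : Pinned P k → ℝ) => f A * g (A + grad (ext0 ν))) :=
    (hf.comp measurable_fst).mul (hg.comp (continuous_fst.add (continuous_grad0.comp continuous_snd)).measurable)
  have hj2 : Measurable (Function.uncurry fun (A : VecField P k) (ν : Pinned P k → ℝ) => f (A - grad (ext0 ν)) * g A) :=
    (hf.comp (continuous_fst.sub (continuous_grad0.comp continuous_snd)).measurable).mul (hg.comp measurable_fst)
  calc ∫⁻ A, f A * orbP g A = ∫⁻ A, ∫⁻ ν : Pinned P k → ℝ, f A * g (A + grad (ext0 ν)) := by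
        refine lintegral_congr fun A => ?_
        rw [orbP, lintegral_const_mul _ (hgm A)]
    _ = ∫⁻ ν : Pinned P k → ℝ, ∫⁻ A, f A * g (A + grad (ext0 ν)) := lintegral_lintegral_swap hj1.aemeasurable
    _ = ∫⁻ ν : Pinned P k → ℝ, ∫⁻ A, f (A - grad (ext0 ν)) * g A := by
        refine lintegral_congr fun ν => ?_
        have h := lintegral_add_right_eq_self (μ := (volume : Measure (VecField P k)))
          (fun B => f (B - grad (ext0 ν)) * g B) (grad (ext0 ν))
        simp only [add_sub_cancel_right] at h
        exact h
    _ = ∫⁻ A, ∫⁻ ν : Pinned P k → ℝ, f (A - grad (ext0 ν)) * g A := (lintegral_lintegral_swap hj2.aemeasurable).symm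
    _ = ∫⁻ A, orbM f A * g A := by
        refine lintegral_congr fun A => ?_
        rw [orbM, lintegral_mul_const _ (hfm A)]

/-- The Faddeev–Popov density `exp(−½‖∂^{η*}A‖²_η)` (the exponential of minus the Feynman gauge-fixing term of (1.11)).
[cite: Balaban1982Higgs1, (1.11) p.605] -/
def gFP (A : VecField P k) : ℝ≥0∞ := ENNReal.ofReal (Real.exp (-divTerm A))

variable (P k) in
/-- The Faddeev–Popov normalisation `c_FP = ∫dλ exp(−½‖∂^{η*}∂^ηλ‖²_η)` over pinned gauge functions. [cite: Balaban1982Higgs1, (1.10) p.605] -/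
def cFP : ℝ≥0∞ := ∫⁻ ν : Pinned P k → ℝ, ENNReal.ofReal (Real.exp (-divTerm (grad (ext0 ν))))

/-- measurability of the Faddeev–Popov density `exp(−½‖∂^{η*}A‖²_η)` (the gauge-fixing term of (1.11)). [cite: Balaban1982Higgs1, (1.11) p.605] -/
theorem measurable_gFP : Measurable (gFP : VecField P k → ℝ≥0∞) :=
  ENNReal.measurable_ofReal.comp (Real.continuous_exp.comp continuous_divTerm.neg).measurable

/-- **The Faddeev–Popov orbit integral is constant**: `∫dλ exp(−½‖∂^{η*}(A + ∂^ηλ)‖²) = c_FP` for EVERY `A` (shift `λ` by the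
solution of the Poisson problem). [cite: Balaban1982Higgs1, (1.10) p.605] -/
theorem orbP_gFP (A : VecField P k) : orbP gFP A = cFP P k := by
  unfold orbP gFP cFP
  have hshift : ∀ ν : Pinned P k → ℝ, divTerm (A + grad (ext0 ν)) = divTerm (grad (ext0 (ν + poisson A))) := by
    intro ν
    unfold divTerm
    congr 1
    rw [div_add, map_add, grad_add, div_add, lap_poisson, add_comm]
  simp_rw [hshift]
  exact lintegral_add_right_eq_self (μ := (volume : Measure (Pinned P k → ℝ)))
    (fun ν => ENNReal.ofReal (Real.exp (-divTerm (grad (ext0 ν))))) (poisson A)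

/-- `0 < c_FP`. [cite: Balaban1982Higgs1, (1.10) p.605] -/
theorem cFP_pos : 0 < cFP P k :=
  lintegral_exp_pos ((continuous_divTerm.comp continuous_grad0).neg)

/-- `c_FP < ∞` (the form `‖∂^{η*}∂^ηλ‖²_η` is positive definite on pinned gauge functions). [cite: Balaban1982Higgs1, (1.10) p.605] -/
theorem cFP_lt_top : cFP P k < ∞ := by
  have h := lintegral_exp_neg_quadratic_lt_top (lap0L : (Pinned P k → ℝ) →ₗ[ℝ] (Site P k → ℝ)) lap0L_injective
    (pow_pos (P.mesh_pos k) P.d)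
  refine lt_of_le_of_lt (le_of_eq ?_) h
  refine lintegral_congr fun ν => ?_
  congr 2
  rw [neg_inj]
  simp only [divTerm, siteSq, lap0L_apply]
  rw [Finset.sum_div, Finset.mul_sum]
  exact Finset.sum_congr rfl fun x _ => by ring

/-- The gauge-invariant Gaussian `exp(−½μ₀²‖A^⊥‖²_η)` of the transverse part. [cite: Balaban1982Higgs1, (1.9) p.605] -/
def gPerp (mu0sq : ℝ) (A : VecField P k) : ℝ≥0∞ := ENNReal.ofReal (Real.exp (-massTerm mu0sq (perp A)))

/-- measurability of `gPerp` (gauge fixing (1.9) → (1.10)). [cite: Balaban1982Higgs1, (1.10) p.605] -/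
theorem measurable_gPerp (mu0sq : ℝ) : Measurable (gPerp mu0sq : VecField P k → ℝ≥0∞) :=
  ENNReal.measurable_ofReal.comp
    (Real.continuous_exp.comp ((continuous_massTerm mu0sq).comp continuous_perp).neg).measurable

variable (P k) in
/-- The gauge-orbit Gaussian of the PROCA weight of (1.8)/(1.9): `c′ = ∫dλ exp(−½μ₀²‖∂^ηλ‖²_η)` over pinned gauge functions.
[cite: Balaban1982Higgs1, (1.9) p.605] -/
def cPrime (mu0sq : ℝ) : ℝ≥0∞ := ∫⁻ ν : Pinned P k → ℝ, ENNReal.ofReal (Real.exp (-massTerm mu0sq (grad (ext0 ν))))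

variable (P k) in
/-- The gauge-orbit Gaussian of the FEYNMAN-GAUGE weight of (1.10)/(1.11): `c = ∫dλ exp(−½μ₀²‖∂^ηλ‖²_η − ½‖∂^{η*}∂^ηλ‖²_η)`.
[cite: Balaban1982Higgs1, (1.10) p.605] -/
def cFull (mu0sq : ℝ) : ℝ≥0∞ :=
  ∫⁻ ν : Pinned P k → ℝ, ENNReal.ofReal (Real.exp (-(massTerm mu0sq (grad (ext0 ν)) + divTerm (grad (ext0 ν)))))

/-- **Orbit integral of the Proca weight**: `∫dλ e^{−½μ₀²‖A − ∂^ηλ‖²} = e^{−½μ₀²‖A^⊥‖²}·c′` (Hodge orthogonality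
`‖A^⊥ − ∂λ‖² = ‖A^⊥‖² + ‖∂λ‖²`, then translation invariance of `dλ`). [cite: Balaban1982Higgs1, (1.9) p.605] -/
theorem orbM_massWeight (mu0sq : ℝ) (A : VecField P k) :
    orbM (fun B => ENNReal.ofReal (Real.exp (-massTerm mu0sq B))) A = gPerp mu0sq A * cPrime P k mu0sq := by
  unfold orbM gPerp cPrime
  have hsplit : ∀ ν : Pinned P k → ℝ, ENNReal.ofReal (Real.exp (-massTerm mu0sq (A - grad (ext0 ν))))
      = ENNReal.ofReal (Real.exp (-massTerm mu0sq (perp A)))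
        * ENNReal.ofReal (Real.exp (-massTerm mu0sq (grad (ext0 (ν - poisson A))))) := by
    intro ν
    rw [sub_grad_eq_perp_sub, ← ENNReal.ofReal_mul (Real.exp_pos _).le, ← Real.exp_add]
    congr 2
    unfold massTerm
    rw [bondSq_sub_grad_of_div_eq_zero (div_perp A)]
    ring
  simp_rw [hsplit]
  have hm : Measurable fun ν : Pinned P k → ℝ =>
      ENNReal.ofReal (Real.exp (-massTerm mu0sq (grad (ext0 (ν - poisson A))))) :=
    (ENNReal.continuous_ofReal.comp (Real.continuous_exp.comp ((continuous_massTerm mu0sq).comp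
      (continuous_grad0.comp (continuous_id.sub continuous_const))).neg)).measurable
  rw [lintegral_const_mul _ hm]
  congr 1
  exact lintegral_sub_right_eq_self (μ := (volume : Measure (Pinned P k → ℝ)))
    (fun ν => ENNReal.ofReal (Real.exp (-massTerm mu0sq (grad (ext0 ν))))) (poisson A)

/-- **Orbit integral of the Feynman-gauge weight**: `∫dλ e^{−½μ₀²‖A−∂λ‖² − ½‖∂*(A−∂λ)‖²} = e^{−½μ₀²‖A^⊥‖²}·c`.
[cite: Balaban1982Higgs1, (1.10) p.605] -/
theorem orbM_fullWeight (mu0sq : ℝ) (A : VecField P k) :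
    orbM (fun B => ENNReal.ofReal (Real.exp (-(massTerm mu0sq B + divTerm B)))) A = gPerp mu0sq A * cFull P k mu0sq := by
  unfold orbM gPerp cFull
  have hsplit : ∀ ν : Pinned P k → ℝ, ENNReal.ofReal (Real.exp (-(massTerm mu0sq (A - grad (ext0 ν)) + divTerm (A - grad (ext0 ν)))))
      = ENNReal.ofReal (Real.exp (-massTerm mu0sq (perp A)))
        * ENNReal.ofReal (Real.exp (-(massTerm mu0sq (grad (ext0 (ν - poisson A)))
            + divTerm (grad (ext0 (ν - poisson A)))))) := by
    intro ν
    rw [sub_grad_eq_perp_sub, ← ENNReal.ofReal_mul (Real.exp_pos _).le, ← Real.exp_add]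
    congr 2
    have hd : divTerm (perp A - grad (ext0 (ν - poisson A))) = divTerm (grad (ext0 (ν - poisson A))) := by
      unfold divTerm
      rw [div_sub, div_perp, zero_sub, siteSq_neg]
    unfold massTerm
    rw [hd, bondSq_sub_grad_of_div_eq_zero (div_perp A)]
    ring
  simp_rw [hsplit]
  have hm : Measurable fun ν : Pinned P k → ℝ => ENNReal.ofReal (Real.exp
      (-(massTerm mu0sq (grad (ext0 (ν - poisson A))) + divTerm (grad (ext0 (ν - poisson A)))))) :=
    (ENNReal.continuous_ofReal.comp (Real.continuous_exp.comp (((continuous_massTerm mu0sq).comp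
      (continuous_grad0.comp (continuous_id.sub continuous_const))).add
      (continuous_divTerm.comp (continuous_grad0.comp (continuous_id.sub continuous_const)))).neg)).measurable
  rw [lintegral_const_mul _ hm]
  congr 1
  exact lintegral_sub_right_eq_self (μ := (volume : Measure (Pinned P k → ℝ)))
    (fun ν => ENNReal.ofReal (Real.exp (-(massTerm mu0sq (grad (ext0 ν)) + divTerm (grad (ext0 ν)))))) (poisson A)

/-- `c ≤ c′` (the gauge-fixing term is non-negative). [cite: Balaban1982Higgs1, (1.10) p.605] -/
theorem cFull_le_cPrime (mu0sq : ℝ) : cFull P k mu0sq ≤ cPrime P k mu0sq := by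
  refine lintegral_mono fun ν => ENNReal.ofReal_le_ofReal (Real.exp_le_exp.2 ?_)
  have : 0 ≤ divTerm (grad (ext0 ν)) := div_nonneg (siteSq_nonneg _) (by norm_num)
  linarith

/-- `0 < c`. [cite: Balaban1982Higgs1, (1.10) p.605] -/
theorem cFull_pos (mu0sq : ℝ) : 0 < cFull P k mu0sq :=
  lintegral_exp_pos (((continuous_massTerm mu0sq).comp continuous_grad0).add (continuous_divTerm.comp continuous_grad0)).neg

/-- `c′ < ∞` for `μ₀² > 0` (the Proca form `μ₀²‖∂^ηλ‖²_η` is positive definite on pinned gauge functions).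
[cite: Balaban1982Higgs1, (1.9) p.605] -/
theorem cPrime_lt_top {mu0sq : ℝ} (hmu : 0 < mu0sq) : cPrime P k mu0sq < ∞ := by
  have h := lintegral_exp_neg_quadratic_lt_top (grad0L : (Pinned P k → ℝ) →ₗ[ℝ] VecField P k) grad0L_injective
    (mul_pos hmu (pow_pos (P.mesh_pos k) P.d))
  refine lt_of_le_of_lt (le_of_eq ?_) h
  refine lintegral_congr fun ν => ?_
  congr 2
  rw [neg_inj]
  simp only [massTerm, bondSq, grad0L_apply]
  rw [Finset.mul_sum, Finset.sum_div, Finset.mul_sum]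
  exact Finset.sum_congr rfl fun b _ => by ring

/-- `c < ∞` for `μ₀² > 0`. [cite: Balaban1982Higgs1, (1.10) p.605] -/
theorem cFull_lt_top {mu0sq : ℝ} (hmu : 0 < mu0sq) : cFull P k mu0sq < ∞ :=
  lt_of_le_of_lt (cFull_le_cPrime mu0sq) (cPrime_lt_top hmu)

end

end Literature.MathematicalPhysics.QuantumFieldTheory.Balaban1983to89.B1Eq110OrbitGaussians
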